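import Summits.QuantumFields.YangMills.Theorems.UnitScaleTiltProp7StubEXOfChartPiecesTwS55
import Summits.QuantumFields.YangMills.Theorems.UnitScaleTiltMinimiserStabilityRegPrOfHalvingExistence
import Summits.QuantumFields.YangMills.Theorems.UnitScaleTiltMinimiserStabilityRegPrStubHalvingStep
import HarnessLib

/-!
# Route `UnitScaleTilt`, crux K1 «MinimiserStabilityRegPr» (stmt-QuantumFields-19200) — **THE CRUX-LEVEL CLOSURE-MODULO OBJECT ON THE EX DISPLAY OF RECORD S55 (✓p782987): THE ROUTE DECL BY NAME FROM EXACTLY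
# THE 9 DISPLAYED ROWS AND NOTHING ELSE — ZERO PRINT ROWS; ONE analytic letter + parameter∕window letters** (★★OWNER g31 WORD 26 (A) ∕ RULINGS №28–№29 ∕ RECORD 17q: the №29 pair is regenerated once
# per EX display event by the routeR-w1 lineage — not seated since g13; this edition by width seat `ym3-torus-px16 g16` with routeR-w1 g13's `gen/gen_crux.py` run VERBATIM on the TREE display, docstrings re-written for the late display)

Cell `ym3-torus` (HUMAN RULING D-0037; rung R3 = SU(2) YM₃ on T³ — NOT d = 4, NOT infinite volume, NOT a mass gap, NOT Clay).  THEOREMS ONLY (0 `def`, 0 `sorry`, 0 `instance`); a decl-local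
`maxHeartbeats 400000` on each of the two theorems (README №24 class, as the S-displays); `--supports stmt-QuantumFields-19200 --as helper`, count-neutral; predecessor objects ✓p730133 (S42ᴸ) … ✓`…OfEXRowsS47` stay true theorems.

WHAT THIS IS.  The kernel certificate that `Summit.QuantumFields.YangMills.Theses.UnitScaleTilt.MinimiserStabilityRegPr` follows from the 9 explicit rows of ✓`stubEX_of_chartPiecesTwS55` and NOTHING
ELSE: skeleton birth_v10 = {H, EX}, H = ✓p705908 `MinimiserStabilityRegPrStubHalvingStep.stub_halvingStep` (hypothesis-free), composition ✓`AttainmentOfExistence.MinimiserStabilityRegPr_of_halvingStep_of_existence`,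
EX = ✓`stubEX_of_chartPiecesTwS55` read on its displayed rows.  At S55 EVERY [Balaban1985BackgroundPropagators] §3 ∕ [Balaban1985Variational] Prop. 7 PRINT ROW of the earlier faces (S42ᴸ: 13,
S45–S47: 11) has been DISCHARGED BY KERNEL inside the display chain (RECORDs 17bs–17bw, 17cz, 17dt, 17dx, 17dy, 17ea); what is displayed is: the parameter∕window letters `αcap hαcap c₀ cB a ha A₁ hA₁`
(the cap `αcap`, the `L²`-weights `c₀ cB`, the LOD coupling `a` in its two-sided window `[1, max A₁ 1]·(c₀∕cB)·(L^{K−n})³`) and the analytic letter `hThm2S3`: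

* `hThm2S3` = [Balaban1985RegularSpaces] THEOREM 2 at the `SU(2)` Setup-torus objects of the members of the block-size-THREE families ONLY (`∃ B₁ c₁ > 0, ∀ F, F.L = 3 → ∀ n < K, ∃ β₀ B₂ len, B8Thm2SetupTorus.Thm2SetupSUAt (F.P K) 2 (K − n) (eta F n K) β₀ B₁ B₂ c₁ len (fun _ => True)`) — the display's former letter `hThm2S` (all L > 1) REDUCED by ★p1 g29 ✓`Prop7Thm2SocketOfCoverForm.hThm2S_of_three`: for EVERY L ≥ 5 Theorem 2 is a HYPOTHESIS-FREE tree theorem ✓`hThm2S_body_of_five_le` (lit-balaban's binder-free EIGHTH cover form ✓p720401 `B8Thm2TorusCoverOfProp6DeltaA.hThm2Cover_of_prop6_deltaA` + ym-inputs ✓`N16Thm2TorusOfCover.thm2TorusAt_of_dvd'` descent by uniqueness; axioms trio re-run from two slots), even L have no `T3Family` member; the L = 3 class is the located residue LF-1EX (`4 ≤ ℓ` in the cover chain) — a PRINT CLAIM displayed as a hypothesis, supplier = lit-balaban's L = 3 re-edition of the cover chain OR a post-freeze re-cut of the crux to L ≥ 5 (planner∕director).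
Binders = the display's VERBATIM (generated by script from the tree file, comments included); conclusion = the route decl BY NAME; proof = one `exact`.
§2 (chair ★p1 g29 WORD №70): the INSTANTIATED corollary `minimiserStabilityRegPr_of_thm2SS55` — the same closure with every parameter∕window letter chosen INSIDE the proof, so that only the analytic letter(s) remain displayed.

WHAT THIS IS NOT (★★OWNER WORD 26 (A), all three): (1) NOT an EX display flip — ✓`stubEX_of_chartPiecesTwS55` stays the display of record and this file changes no row of it; (2) NOT a registry
event — helper mode, no `closes`, no binder, no `birth_v10` ∕ J-r4 edit (J-FREEZE to 2026-09-02 honoured); the gate's closure-modulo list for this decl IS the face; (3) it CREDITS NOTHING —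
CONDITIONAL by construction: `hThm2S3` is a hypothesis, so neither `stub_existenceMinimalOrbit` nor the crux is proved here; every display reduction above was a reduction BY KERNEL to named
letters, not a proof of Prop. 7 in print's generality.  Also: not d = 4, not infinite volume, not a mass gap, not Clay; the YM mass gap is NOT proved.
References: T. Bałaban, CMP 102 (1985) 277–309 [Balaban1985Variational] (Thm 1 (6)–(10) pp.278–279, Prop. 7 p.299, Prop. 8 p.304); CMP 99 (1985) 389–434 [Balaban1985BackgroundPropagators]
(Thm 3.1 (3.42)–(3.44) pp.397–398, Thm 3.11 p.416); CMP 99 (1985) 75–102 [Balaban1985RegularSpaces] (Thm 2 p.83, (1.33)–(1.39) pp.82–83); CMP 98 (1985) 17–51 [Balaban1985Averaging] (Prop. 5 p.42).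
-/

set_option autoImplicit false

noncomputable section

open scoped BigOperators Matrix.Norms.L2Operator Matrix InnerProductSpace

namespace Summit.QuantumFields.YangMills.Theorems.MinimiserStabilityRegPrOfEXRowsS55

open NormedSpace
open Literature.Analysis.Calculus.ExpDifferential (ad gSer)
open Literature.MathematicalPhysics.QuantumFieldTheory.Balaban1983to89
open Literature.MathematicalPhysics.QuantumFieldTheory.Balaban1983to89.T3ContinuumYM3Torus
open Literature.MathematicalPhysics.QuantumFieldTheory.Balaban1983to89.T3UnitLawDensityEML (ℰp)
open Literature.MathematicalPhysics.QuantumFieldTheory.Balaban1983to89.T3TiltDescent (descendTo)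
open Literature.MathematicalPhysics.QuantumFieldTheory.Balaban1983to89.T3ConstrainedMinimiser (fibre)
open Literature.MathematicalPhysics.QuantumFieldTheory.Balaban1983to89.T3PrintedRegularMinimiser (RegPr regFibrePr)
open Literature.MathematicalPhysics.QuantumFieldTheory.Balaban1983to89.T3Thm1Carrier
open Literature.MathematicalPhysics.QuantumFieldTheory.Balaban1983to89.T3SectALandauChart (In19 emb15 CloseAvg eta bgUnits pert)
open B9SectCLatticeCarrier (Bond)
open B9Eq311L2Pairing (WL2)
open B10Eq27TorusAxialLog (unitsField toUField pull transl holT)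
open B11Eq115Space (NegSup NegSize Space115 JetSup levWeight)
open B11Eq111FrakG (nabla115)
open B11Eq98CurrentSlot (Jcur)
open B11Eq103H1Complex (BondL2K funEquiv SiteL2K laplaceAK)
open B11Prop3Model (Dfix)
open B13Contraction113 (QuadAnalytic)
open B8Thm2SetupTorus (Thm2SetupSUAt)
open MatrixLog (mlog)
open Summit.QuantumFields.YangMills.Theorems.Prop7TPrint (nMax19 expHermField)
open Summit.QuantumFields.YangMills.Theorems.Prop7SPrint (NormS IsLandauPrintS basePt RestrictedPrint isLandauPrintS_iff_RS AvgCondPrint IsLandauPrint)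
open Summit.QuantumFields.YangMills.Theorems.Prop7SectET3Transport (periodsT3 bgOfCfg bondEquiv)
open Summit.QuantumFields.YangMills.Theorems.Prop7SectET3HilbertLetters (W₂ toL2 toL2B DL2 DstarL2 frobEquiv covLapSite toL2S)
open Summit.QuantumFields.YangMills.Theorems.Prop7SectET3GaugeProjector (RS)
open Summit.QuantumFields.YangMills.Theorems.Prop7SymAvgTwSym (QTwS CmapTwS Chart47T3twS)
open Summit.QuantumFields.YangMills.Theorems.Prop7SymAvgGL (QSym descendToGL)
open Summit.QuantumFields.YangMills.Theorems.Prop7SectET3CurvedPropagators (laplaceA PosOnto frakGfR H1f QTwS_Hf Qk GT KinvT)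
open Summit.QuantumFields.YangMills.Theorems.Prop7SectET3DeltaPiPInv (DeltaPiSlotP H46P inner_DL2_DeltaPiP_eq_zero GprimeP)
open Summit.QuantumFields.YangMills.Theorems.Prop7SectET3DeltaOnePInv (DeltaOnePJ TJSlotP DeltaOneP_kills_NS inner_DL2_DeltaOneP_eq_zero)
open Summit.QuantumFields.YangMills.Theorems.Prop7HDsolAtRecordOfRowsTwoSlotFamilyLLift (hΔsol_of_opRows_twoSlot_familyL)
open Summit.QuantumFields.YangMills.Theorems.Prop7HWROfRowsFamily (hWR_of_rows_family)
open Summit.QuantumFields.YangMills.Theorems.Prop7Prop4OfW80RowsAtRecord (prop4_W80_family)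
open Summit.QuantumFields.YangMills.Theorems.Prop7DeltaEtaHfCompositeNorm (hN₁_family_of_rows)
open Summit.QuantumFields.YangMills.Theorems.Prop7RieszTauFrobNorm (opNorm_rieszτ_frobEquiv_le_one opNorm_trace_clm_le_two hqV_record_family)
open Summit.QuantumFields.YangMills.Theorems.Prop7V0CurrentReality (hV0_of_RC_family)
open Summit.QuantumFields.YangMills.Theorems.Prop7ThetaOfColumnLettersT3 (theta_rows_family_of_columnLetters)
open Summit.QuantumFields.YangMills.Theorems.Prop7RCOfRowsFamily (hRC_of_rows_family_B₀)
open Summit.QuantumFields.YangMills.Theorems.Prop7RealityRowsFamily (hHfR_family hH₁R_family h𝒢R_family)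
open B11Eq63V0GroupCurrent (curV0)
open B11Eq80Current (Emap E3 W80)
open B11Eq90Transpose (kernel single115)
open B11Eq90V0primeCurrent (flat115)
open B11Eq174Chart (Regime)
open B11Eq90V0GroupComposed (curV0full T47)
open Summit.QuantumFields.YangMills.Theorems.Prop7SectET3EXJunction (h102_of_posOnto h129_of_posOnto h45_of_posOnto h102LS_of_posOnto h129LS_of_posOnto)
open Summit.QuantumFields.YangMills.Theorems.Prop7H46GradRow (h46_rows_of_norm115)
open Summit.QuantumFields.YangMills.Theorems.Prop7QkOntoOfRegPr (surjective_Qk_of_regPr)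
open T3SectALandauChart (bgUnits covGradT covCodiffCurlT covLapFormT)

open Summit.QuantumFields.YangMills.Theorems.Prop7SectET3WilsonHessian (DeltaEta DeltaEtaSlot)
open Summit.QuantumFields.YangMills.Theorems.Prop7H46TwoOfOpRowsFamily (hBH₂_of_nonneg)
open Summit.QuantumFields.YangMills.Theorems.Prop7HDsolAtRecordOfRowsFamily (hMΔ_of_nonneg)
open Summit.QuantumFields.YangMills.Theorems.Prop7H46PTwoOfOpRowsFamily (h46₂P_of_opRows_family)

open B11Eq98V0primeCurrentSlots (rieszτ)
open B9Eq3119DeltaPiCarrier (currentCLM)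
open Summit.QuantumFields.YangMills.Theorems.Prop7ColumnRowsOfKernelDecay (hHcol_of_kernel133_family hΔHcol_of_kernel88_family thetaH_nonneg thetaΔ_nonneg)
open Summit.QuantumFields.YangMills.Theorems.Prop7Op349OfKernelRow (hOp349_of_kernel349_family k349_nonneg)
open Summit.QuantumFields.YangMills.Theorems.Prop7PA2OfSymDiffDivRows (hPA2_of_symL1_diffL1_divSlice)
open Summit.QuantumFields.YangMills.Theorems.Prop7DivSliceRowHolds (hV_holds)
open Summit.QuantumFields.YangMills.Theorems.Prop7HcoSOfNormG0DiffRow (hS_holds)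
open Summit.QuantumFields.YangMills.Theorems.Prop7StubEXOfChartPiecesTwS25LLift (stubEX_of_chartPiecesTwS25L)
open Summit.QuantumFields.YangMills.Theorems.Prop7Op139OfGaugeColumnLift (hOp139π_of_gaugeColumn_family)
open Summit.QuantumFields.YangMills.Theorems.Prop7Op139OfGaugeColumn (k139_nonneg)
open Summit.QuantumFields.YangMills.Theorems.Prop7DivRecoveryPatchRows (patch_rows)
open Summit.QuantumFields.YangMills.Theorems.Prop7QH1DoorHolds (hQH1_doorH_holds)
open Summit.QuantumFields.YangMills.Theorems.Prop7HN06OfPatch (hN06_of_patchRows)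
open Summit.QuantumFields.YangMills.Theorems.Prop7CombHMc2Holds (hMc₂_holds)
open Summit.QuantumFields.YangMills.Theorems.Prop7N32SymRow (hN2s_holds)
open Summit.QuantumFields.YangMills.Theorems.Prop7CombHMcombHolds (hMcomb_holds)
open Literature.MathematicalPhysics.QuantumLattice (blockBase)
open T3LevelShift (bondShift siteShift)
open B7Eq78Linearization (conjR)
open B7Prop1Explicit (U1 expUnit)
open T4TermwiseTorus (tlift)
open Summit.QuantumFields.YangMills.Theorems.Prop7QprimeCombL2 (RcombL2)
open B7Eq92Concrete (tildIter)
open BlockAveragingEMLLinearisedBackground (pertVar)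
open ExpMeanLog (expMeanLogSU)
open BlockAveraging (blockAvg)
open Summit.QuantumFields.YangMills.Theorems.Prop7CovKernel157Family (hC157_family)
open B9Eq39Adjoint (curl divB)
open B9TorusCalculus (torusT)
open Summit.QuantumFields.YangMills.Theorems.Prop7SectET3CombLetters (Qkc)
open Summit.QuantumFields.YangMills.Theorems.Prop7SymAvgTw (CmapTw)
open Summit.QuantumFields.YangMills.Theorems.Prop7CcolOf157Entry (hCcol_of_157_family hG0_of_hg0)
open Prop8Chart (emlIterU)
open B15DeterminingSets (embIter)
open Summit.QuantumFields.YangMills.Theorems.Prop7Op137OfKernelRows (h137π_of_kernel137_family h137Δ_of_kernel137_family hOpC_of_kernelC_family)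
open B5Eq118OneStroke (iterBlockOf)
open T3PrintedRegularOrbits (sites_eq)
open Summit.QuantumFields.YangMills.Theorems.Prop7CmapTwSupRow (hcoS_of_normG0_of_combRemainderL1Rows)
open Summit.QuantumFields.YangMills.Theorems.Prop7HDOfCombRows (hD_of_hMcomb)
open Summit.QuantumFields.YangMills.Theorems.Prop7IrrLiftRowOfRecord (hIrrLift_of_record)
open Summit.QuantumFields.YangMills.Theorems.Prop7EXNumeralRowsInhabited (ex_numeral_rows_inhabited)

open Summit.QuantumFields.YangMills.Theorems.Prop7StubEXOfChartPiecesTwS43LT2 (stubEX_of_chartPiecesTwS43LT2)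
open Summit.QuantumFields.YangMills.Theorems.Prop7PositivityBlockDoorLiftedRows (positivityRows_lift_of_liftedRows)
open Summit.QuantumFields.YangMills.Theorems.Prop7TJRowOfEntry157Lift (hTJ_of_hHcol_h157)
open Summit.QuantumFields.YangMills.Theorems.Prop7ColumnRowsOfKernelDecayLift (hHcol_of_kernel133_family)

open Summit.QuantumFields.YangMills.Theorems.Prop7StubEXOfChartPiecesTwS44LG (stubEX_of_chartPiecesTwS44LG)
open Summit.QuantumFields.YangMills.Theorems.Prop7GaugeFixedRowDoorOfLODTarget (gaugeFixedRow_idx_of_curvedTarget_of_le_coupling)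
open T3PrintedMinimiserExistence (regPr_mono)
open B7TransferAnalyticMean (meanCLM)
open B11Eq103H1Complex (projR)
open Summit.QuantumFields.YangMills.Theorems.Prop7SectET3GaugeProjector (NS)
open B7Prop1Explicit (disp)
open T4Continuum BlockAveraging

open Summit.QuantumFields.YangMills.Theorems.Prop7StubEXOfChartPiecesTwS45 (stubEX_of_chartPiecesTwS45)
open Summit.QuantumFields.YangMills.Theorems.Prop7KernelRow349DoorOfLODTarget (kernelRow349_idx_of_projRTarget)
open T3PrintedMinimiserExistence (regPr_mono)
open B7TransferAnalyticMean (meanCLM)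
open B11Eq103H1Complex (projR)
open Summit.QuantumFields.YangMills.Theorems.Prop7SectET3GaugeProjector (NS)
open B7Prop1Explicit (disp)
open T4Continuum BlockAveraging

open Summit.QuantumFields.YangMills.Theorems.Prop7StubEXOfChartPiecesTwS46 (stubEX_of_chartPiecesTwS46)
open T3PrintedMinimiserExistence (regPr_mono)
open B7TransferAnalyticMean (meanCLM)
open B11Eq103H1Complex (projR)
open Summit.QuantumFields.YangMills.Theorems.Prop7SectET3GaugeProjector (NS)
open B7Prop1Explicit (disp)
open T4Continuum BlockAveraging
open Summit.QuantumFields.YangMills.Theorems.Prop7StubEXOfChartPiecesTwS47 (stubEX_of_chartPiecesTwS47)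
open Summit.QuantumFields.YangMills.Theorems.Prop7H133FamilyPackageAllMembers (h133_family_exists_allMembers h137kpi_family_exists_allMembers)
open T3PrintedMinimiserExistence (regPr_mono)
open Summit.QuantumFields.YangMills.Theorems.Prop7StubEXOfChartPiecesTwS48 (stubEX_of_chartPiecesTwS48)
open Summit.QuantumFields.YangMills.Theorems.Prop7NormHpiFamilyPackageAllMembers (normHpi_family_exists_allMembers)
open Summit.QuantumFields.YangMills.Theorems.Prop7H88FamilyPackageAllMembers (h88_family_exists_allMembers)
open Summit.QuantumFields.YangMills.Theorems.Prop7KRows78EtaTJFamilyPackageAllMembers (hCk_family_exists_allMembers)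
open Summit.QuantumFields.YangMills.Theorems.Prop7KRows78EtaTJFamilyPackageAllMembers (h137kDelta_family_exists_allMembers)
open T3PrintedMinimiserExistence (regPr_mono)
open Summit.QuantumFields.YangMills.Theorems.Prop7StubEXOfChartPiecesTwS49 (stubEX_of_chartPiecesTwS49)
open Summit.QuantumFields.YangMills.Theorems.Prop7NormHoneFamilyPackageAllMembers (normHone_family_exists_allMembers)
open Summit.QuantumFields.YangMills.Theorems.Prop7SectET3DeltaOne (avgHess)
open T3PrintedMinimiserExistence (regPr_mono)
open Summit.QuantumFields.YangMills.Theorems.Prop7StubEXOfChartPiecesTwS50 (stubEX_of_chartPiecesTwS50)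
open Summit.QuantumFields.YangMills.Theorems.Prop7NormGFamilyPackageAllMembers (normG_family_exists_allMembers)
open Summit.QuantumFields.YangMills.Theorems.Prop7SectET3DeltaOnePInv (DeltaOneP)
open T3PrintedMinimiserExistence (regPr_mono)
open Summit.QuantumFields.YangMills.Theorems.Prop7StubEXOfChartPiecesTwS51 (stubEX_of_chartPiecesTwS51)
open Summit.QuantumFields.YangMills.Theorems.Prop7StoreyHGradientFamily (h3_family_exists)
open B10Eq27TorusAxialLog (axialT)
open B4Sect5Torus (TSite tdist)
open Summit.QuantumFields.YangMills.Theorems.Prop7SectET3Transport (siteEquiv)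
open Summit.QuantumFields.YangMills.Theorems.CoverSites
open Summit.QuantumFields.YangMills.Theorems.Prop7StubEXOfChartPiecesTwS52 (stubEX_of_chartPiecesTwS52)
open Summit.QuantumFields.YangMills.Theorems.Prop7AvgHessGaugeHqGClosed (hqG_family_closed qG_family_closed_nonneg)
open Summit.QuantumFields.YangMills.Theorems.Prop7StubEXOfChartPiecesTwS53 (stubEX_of_chartPiecesTwS53)
open Summit.QuantumFields.YangMills.Theorems.Prop7Thm2SocketOfCoverForm (hThm2S_of_three)
open B8Thm2SetupTorus (Thm2SetupSUAt)
open Summit.QuantumFields.YangMills.Theorems.Prop7StubEXOfChartPiecesTwS54 (stubEX_of_chartPiecesTwS54)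
open Summit.QuantumFields.YangMills.Theorems.Prop7OmegaOneAxialHolderFamily (hHωw_family_exists)
open Summit.QuantumFields.YangMills.Theorems.Prop7StubEXOfChartPiecesTwS55 (stubEX_of_chartPiecesTwS55)
open Summit.QuantumFields.YangMills.Theorems.AttainmentOfExistence (MinimiserStabilityRegPr_of_halvingStep_of_existence)
open Summit.QuantumFields.YangMills.Theorems.MinimiserStabilityRegPrStubHalvingStep (stub_halvingStep)

set_option maxHeartbeats 400000 in
-- hb: the statement carries the full EX face (9 binders); the one `exact` instantiates the display by name — same class as the S-displays (README №24).
/-- ★★★ **THE CRUX DECL FROM THE EX FACE (S55) — CLOSURE MODULO EXACTLY THESE ROWS.**  Hypotheses = ✓`stubEX_of_chartPiecesTwS55`'s 9 displayed rows VERBATIM (ZERO print rows;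
parameter∕window letters `αcap hαcap c₀ cB a ha A₁ hA₁`; analytic letter `hThm2S3`); conclusion = the ROUTE DECL `Summit.QuantumFields.YangMills.Theses.UnitScaleTilt.MinimiserStabilityRegPr` BY NAME;
proof = ✓`MinimiserStabilityRegPr_of_halvingStep_of_existence` ✓`stub_halvingStep` (✓`stubEX_of_chartPiecesTwS55` …).  CONDITIONAL; not a display flip; not a registry event; credits nothing.
[cite: Balaban1985Variational, Thm 1 (6)-(10) pp.278-279, Prop. 7 p.299, Prop. 8 p.304; Balaban1985BackgroundPropagators, Thm 3.1 (3.42)-(3.44) pp.397-398; Balaban1985RegularSpaces, Thm 2 p.83] -/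
theorem minimiserStabilityRegPr_of_EXrowsS55
    [hFL : ∀ F : T3Family, Fact (0 < (F.L : ℝ))]
    [hFη : ∀ (F : T3Family) (k : ℕ), Fact (0 < ((F.L : ℝ)⁻¹) ^ k)]
    -- (PRINT-SHAPE EVENT) the ONE regularity cap below which every print row is asked («for U₀ ∈ 𝔄(ρ), ρ ≤ αcap» — [B9] Thm 3.3∕3.11∕3.12 shape); the census letters `C₄ a₃ α r M εC ef ε′`
    -- (with `α ≤ αcap`) and ALL 23 numeral rows + their 6 signs are chosen INSIDE the proof by ✓`Prop7EXNumeralRowsInhabited.ex_numeral_rows_inhabited` (px19 g7 ∕ ★p1 g20 SIGNATURE-0)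
    (αcap : ℕ → ℝ) (hαcap : ∀ L : ℕ, 1 < L → 0 < αcap L)
    (c₀ cB : ℕ → ℝ)
    [hc₀ : ∀ L : ℕ, Fact (0 < c₀ L)]
    [hcB : ∀ L : ℕ, Fact (0 < cB L)]
    (a : ∀ L : ℕ, Idx L → ℝ)
    -- (S45, ★★OWNER WORD 63 shape (B)) the display's coupling `a` is FREE above the LOD line's coupling `a₀·(c₀∕cB)·(L^{K−n})³` (`a₀ := 1`): the ONE changed row
    (ha : ∀ (L : ℕ) (i : Idx L), (c₀ L / cB L) * ((i.1.1.L : ℝ) ^ (i.1.2.2 - i.1.2.1)) ^ 3 ≤ a L i)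
    -- (S48, ★★OWNER RECORD 17cz (b)) the ONE new display letter: the coupling's UPPER pin, so that the K-storey's two-sided coupling window `[1, max A₁ 1]·(c₀∕cB)·(L^{K−n})³` holds
    (A₁ : ℝ)
    (hA₁ : ∀ L : ℕ, 1 < L → ∀ i : Idx L, a L i ≤ A₁ * ((c₀ L / cB L) * ((i.1.1.L : ℝ) ^ (i.1.2.2 - i.1.2.1)) ^ 3))
    -- ([B8] Thm 2 letter, L = 3 INSTANCE ONLY — ★p1 g29 ✓`hThm2S_of_three`: for every block size L ≥ 5 the body of `hThm2S` is a TREE THEOREM via lit-balaban's binder-free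
    -- cover form ✓`B8Thm2TorusCoverOfProp6DeltaA.hThm2Cover_of_prop6_deltaA` (4 ≤ ℓ); even L carry no `T3Family` member; so only the L = 3 class stays displayed — text = the socket's `h3` VERBATIM)
    (hThm2S3 : ∃ B₁ c₁ : ℝ, 0 < B₁ ∧ 0 < c₁ ∧ ∀ (F : T3Family), F.L = 3 → ∀ (n K : ℕ), n < K →
      ∃ (β₀ B₂ : ℝ) (len : B7Prop1Explicit.Site (F.P K).d → ℝ),
        Thm2SetupSUAt (F.P K) 2 (K - n) (eta F n K) β₀ B₁ B₂ c₁ len (fun _ => True)) :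
    Summit.QuantumFields.YangMills.Theses.UnitScaleTilt.MinimiserStabilityRegPr := by
  exact MinimiserStabilityRegPr_of_halvingStep_of_existence stub_halvingStep (stubEX_of_chartPiecesTwS55
    αcap hαcap c₀ cB a ha A₁ hA₁ hThm2S3)

set_option maxHeartbeats 400000 in
-- hb: same class as the face above (one `exact` through the display by name).
/-- ★★★ **THE INSTANTIATED COROLLARY (chair ★p1 g29 WORD №70)** — the same closure with EVERY parameter∕window letter of the display CHOSEN INSIDE the proof (`hFL`∕`hFη` from `F.hL`,
`αcap := 1`, `c₀ = cB := 1`, `a L i := ((1 : ℝ) / 1)·(L^{K−n})³` so `ha := le_rfl`, `A₁ := 1`): what is DISPLAYED is exactly the analytic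
letter(s) {`hThm2S3`}.  READING: «crux 19200 `MinimiserStabilityRegPr` BY NAME ⟸ exactly these» — i.e. modulo [Balaban1985RegularSpaces] Thm 2 AT BLOCK SIZE L = 3 ONLY (L ≥ 5: ✓`hThm2S_body_of_five_le`, hypothesis-free).  CONDITIONAL; credits nothing;
not a display flip; not a registry event. [cite: Balaban1985RegularSpaces, Thm 2 p.83; Balaban1985Variational, Prop. 7 p.299] -/
theorem minimiserStabilityRegPr_of_thm2SS55
    (hThm2S3 : ∃ B₁ c₁ : ℝ, 0 < B₁ ∧ 0 < c₁ ∧ ∀ (F : T3Family), F.L = 3 → ∀ (n K : ℕ), n < K →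
      ∃ (β₀ B₂ : ℝ) (len : B7Prop1Explicit.Site (F.P K).d → ℝ),
        Thm2SetupSUAt (F.P K) 2 (K - n) (eta F n K) β₀ B₁ B₂ c₁ len (fun _ => True)) :
    Summit.QuantumFields.YangMills.Theses.UnitScaleTilt.MinimiserStabilityRegPr := by
  haveI hFL : ∀ F : T3Family, Fact (0 < (F.L : ℝ)) := fun F => ⟨by have h := F.hL.2; exact_mod_cast (lt_trans zero_lt_one h)⟩
  haveI hFη : ∀ (F : T3Family) (k : ℕ), Fact (0 < ((F.L : ℝ)⁻¹) ^ k) := fun F k => ⟨pow_pos (inv_pos.mpr (hFL F).out) k⟩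
  haveI hone : ∀ L : ℕ, Fact (0 < ((fun _ : ℕ => (1 : ℝ)) L)) := fun _ => ⟨one_pos⟩
  have hA₁' : ∀ L : ℕ, 1 < L → ∀ i : Idx L, (fun (L : ℕ) (i : Idx L) => ((1 : ℝ) / 1) * ((i.1.1.L : ℝ) ^ (i.1.2.2 - i.1.2.1)) ^ 3) L i ≤
      (1 : ℝ) * (((1 : ℝ) / 1) * ((i.1.1.L : ℝ) ^ (i.1.2.2 - i.1.2.1)) ^ 3) := fun L hL i => by
    simp only [one_mul, le_refl]
  exact MinimiserStabilityRegPr_of_halvingStep_of_existence stub_halvingStep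
    (stubEX_of_chartPiecesTwS55
      (fun _ => (1 : ℝ)) (fun L hL => one_pos) (fun _ => (1 : ℝ)) (fun _ => (1 : ℝ)) (fun (L : ℕ) (i : Idx L) => ((1 : ℝ) / 1) * ((i.1.1.L : ℝ) ^ (i.1.2.2 - i.1.2.1))
      ^ 3) (fun L i => le_rfl) (1 : ℝ) hA₁' hThm2S3)

end Summit.QuantumFields.YangMills.Theorems.MinimiserStabilityRegPrOfEXRowsS55

end
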